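import Summits.MatrixMultiplication.MatrixMultiplication.Theorems.ObstructionDescentUniversalOccurrenceTwoRectangleHookFour
import Summits.MatrixMultiplication.MatrixMultiplication.Theorems.ObstructionDescentUniversalOccurrenceTwoRectangleHookThree
import Summits.MatrixMultiplication.MatrixMultiplication.Theorems.ObstructionDescentUniversalOccurrenceTwoRectangleHookTwoRows

set_option linter.dupNamespace false
set_option autoImplicit false

/-!
# Universal occurrence — two rectangles and a HOOK, part E: the family `((2^N),(2^N),(2N-2j,2^j))`, `j ≤ 3` (decomp-mm · lens 3 · gen 43)

Route `route-MatrixMultiplication-ObstructionDescent` (sub-problem `MatrixMultiplication`, `ω(ℂ) = 2`); SUPPORT for the crux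
`NoOccurrenceObstruction` (`P_O`, item `stmt-MatrixMultiplication-29040`) through the universal-occurrence programme (NODE-g29…g43
of the decomp-mm cell, lens 3).  Nothing here proves `ω = 2` or closes an item; no `def`, no `sorry`, standard axioms.  Closure
currency as in parts I–IX: "the triple `(λ⁰,λ¹,λ²)` occurs for `s`" is `isotypicSum₁ λ⁰ (isotypicSum₂ λ¹ (isotypicSum₃ λ² (s^{⊗d}))) ≠ 0`.

**This file.**  `occurs_unitTensor_twoRectangle_doubleHook`: for `j ≤ 3` and all `m ≥ N ≥ j + 1` the type `((2^N),(2^N),(2N-2j,2^j))`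
occurs for `⟨m⟩` — third legs with up to FOUR rows, uniformly in the format `N` (assembly of parts B, C, D).  Consequently no type
of this family is ever an occurrence obstruction for `⟨m⟩`, `m ≥ N`.  Scope note (NODE-g43 §3, not formalised): a single-polytabloid
twin certificate exists only for lower parts `μ` (`ν/2` minus its first row) with `μ₁ ≤ 2 ∨ μ₂ ≤ 1`; for `(3,3) ⊆ μ` every design
carries Latin-square sub-configurations of both signs (exact counts `+8/−172` for the vertical design of `(3,3,2)`, `+72/−996` for
`(3,3,3)`), and the domino parts `(2^k)`, `k ≥ 2`, are constant-sign but not twin-forcing.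

[cite: BurgisserIkenmeyer2011, §3.4 (Prop. 3.4), Thm. 4.4] [cite: BurgisserIkenmeyer2017, §5, Thm. 5.9 (proof of (2)), eq. (3.4)]
[cite: Landsberg2017, §9.1.1]
-/

noncomputable section

open scoped BigOperators

namespace Summit.MatrixMultiplication.MatrixMultiplication.Theorems.ObstructionCalculus

open Literature.Computability.AlgebraicComplexity
open Literature.NumberTheory.DiophantineGeometry

/-! ### §7 The family `j ≤ 3` -/

/-- **Hook family.**  For `j ≤ 3` and all `m ≥ N ≥ j + 1` the type `((2^N),(2^N),(2N-2j,2^j))` occurs for `⟨m⟩`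
(in `(ℂ^m ⊗ ℂ^m ⊗ ℂ^m)^{⊗ 2N} ≅ ⟨m^{2N}⟩ ⊇` the `GL_m^{×3}`-degenerations of `⟨m⟩^{⊗ 2N}`): third legs with up to four
rows, uniformly in `N` — in particular these types can never serve as occurrence obstructions against
`R̲(⟨m⟩) ≤ m^2·(const)`-type bounds built from `(2^N),(2^N)` on the first two legs.
[cite: BurgisserIkenmeyer2011, Thm. 4.4] [cite: BurgisserIkenmeyer2017, Thm. 5.9 (proof of (2))] -/
theorem occurs_unitTensor_twoRectangle_doubleHook {N m j : ℕ} (hj : j ≤ 3) (hN : j + 1 ≤ N) (hNm : N ≤ m)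
    {lam : Fin 3 → Nat.Partition (N * 2)} (h0 : lam 0 = Nat.Partition.rectangle N 2)
    (h1 : lam 1 = Nat.Partition.rectangle N 2)
    (h2 : (lam 2).sortedParts = (2 * N - 2 * j) :: List.replicate j 2) :
    isotypicSum₁ (lam 0) (isotypicSum₂ (lam 1) (isotypicSum₃ (lam 2)
      (kroneckerPow (unitTensor ℂ m) (N * 2)))) ≠ 0 := by
  interval_cases j
  · exact occurs_unitTensor_twoRectangle_doubleHook_zero hN hNm h0 h1 h2
  · exact occurs_unitTensor_twoRectangle_doubleHook_one hN hNm h0 h1 h2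
  · exact occurs_unitTensor_twoRectangle_doubleHook_two hN hNm h0 h1 h2
  · exact occurs_unitTensor_twoRectangle_doubleHook_three hN hNm h0 h1 h2

end Summit.MatrixMultiplication.MatrixMultiplication.Theorems.ObstructionCalculus
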